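import Literature.Computability.MetaComplexity.RefuterExpClosure
import Literature.Computability.MetaComplexity.RefuterListSearch
import HarnessLib

/-!
# Refuters for `EXP` against `BPP` (Chen–Jin–Santhanam–Williams, Thm. 1.2), III: the theorem

Topic `Literature/Computability/MetaComplexity`. Discharge of the named fact
`constructiveSeparation_of_not_subset_BPP_EXP` of `ConstructiveSeparations.lean`:

> **Theorem 1.2 of [ChenEtAl2022] for `(𝒞, 𝒟) = (BPP, EXP)`.** If `EXP ⊄ BPP` then for every
> paddable `EXP`-complete language `L` there is a `BPP`-constructive separation of `L ∉ BPP`: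
> against every `L'' ∈ BPP` some probabilistic polynomial-time refuter, on input `1ⁿ`, prints an
> `n`-bit string of `L ∆ L''` with probability `≥ 2/3`, for infinitely many `n`.

(L. Chen, C. Jin, R. Santhanam, R. Williams, *Constructive separations and their consequences*,
FOCS 2021; proved in arXiv:2203.14379v5, §5.1 as Thm. 5.4 with the list-refuter lemma and Algorithm 1.)
The proof follows the printed one, assembled from parts I (`RefuterExpClosure.lean`: `G ∈ EXP`,
infinitely many bad lengths) and II (`RefuterListSearch.lean`: the list-refuter and its
analysis):

1. Fix `L'' ∈ BPP`. Bad lengths `n` (some `n`-bit string in `L ∆ L''`) are infinitely many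
   (`frequently_exists_mismatch`).
2. *Amplification* ("by standard amplification there is another `BPP` algorithm `A'` …"): an
   amplified witness `L_amp ∈ P` of `L''` with error `≤ 1/(6m + 6)` on inputs of length `m`,
   depending on the first `p''(m)` coins (`PromiseProblem.exists_amplifier_of_mem_PromiseBPP'`;
   we amplify to an inverse polynomial and union-bound over the `≤ 2(n + 1)` queries of the
   canonical run, instead of the printed `2⁻²ⁿ` and a union bound over all of `{0,1}ⁿ` — the same
   argument localised to the queries actually made).
3. *The query map* `Q⟨u, w⟩ = pad(f⟨1ⁿ, w⟩, ℓ(n))`, `n = |u|`: `f` a Karp reduction of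
   `G = G_{L ∆ L''} ∈ EXP` to `L`, padded to the exact length `ℓ(n) = s(3n + 3) + n + 1` (`s` an
   output-length bound of `f`), `ℓ` strictly increasing ("since `L` is paddable, we may assume the
   queries … have length exactly `ℓ(n)`").
4. *The four refuters* (the list-refuter lemma of §5.1: "define `B⁽ⁱ⁾` to be the algorithm that prints `x⁽ⁱ⁾ₙ` on input
   `1^{ℓ⁽ⁱ⁾(n)}` … at least one of `B⁽¹⁾, …, B⁽ᶜ⁾` prints valid counterexamples for infinitely
   many `n`"): `B₀(1ⁿ) = w*` (the final state of Algorithm 1 run with the coin oracle) and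
   `B_e(1^{ℓ(n)}) = Q⟨1ⁿ, e(w*)⟩` for `e ∈ {id, 0·, 1·}`, all `strRefuter`s of `FP` maps
   (`F₀_mem_FP`, `Fe_mem_FP`), with exactly polynomial coin budgets `p'' ∘ ℓ`, `p''`.
5. *Probability* (`uniformProb_badCoins_le`, `crun_eq_of_not_mem_badCoins`): outside an event of
   probability `≤ 2(n+1)/(6(n+1)) = 1/3` the coins answer every canonical query like `L''`, so the
   machine's run IS the canonical run against `L''` (`crun_congr`) — the refuters are
   pseudo-deterministic, as the printed proof notes.
6. *Correctness* (`exists_success`, from `crun_full_of_consistent`): at a bad length `n ≥ 1` one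
   of the four canonical outputs is a counterexample of the right length (`n`, resp. `ℓ(n)`),
   hence one of the four refuters succeeds with probability `≥ 2/3`; by the pigeonhole principle
   over the infinitely many bad `n` (`Filter.frequently_or_distrib`) one FIXED refuter succeeds
   infinitely often (`exists_refuter`), and `m = ℓ(n) → ∞`.

## Main statements

* `RefData`: the data of steps 2–3 for fixed `L`, `L''`; `RefData.exists_refuter`;
* `constructiveSeparation_of_not_subset_BPP_EXP_holds`.

(The sibling `ConstructiveSeparationsProofs.lean` holds the `(P, NP)` instance; this file is the
`(BPP, EXP)` instance.)

## References

* [ChenEtAl2022] L. Chen, C. Jin, R. Santhanam, R. Williams, *Constructive separations and their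
  consequences*, FOCS 2021, pp. 646–657 (IEEE 2022), doi:10.1109/focs52979.2021.00069;
  arXiv:2203.14379v5: Def. 1.1, Thm. 1.2; §5.1: constant-size list-refuters and the lemma converting
  them into refuters, Thm. 5.4 (`𝒟 ∈ {PSPACE, EXP, NEXP}`), Algorithm 1, and the corollary for the pairs
  `{P, ZPP, BPP} × {PSPACE, EXP, NEXP, EXP^NP}`.
* [AroraBarakCC2009] S. Arora, B. Barak, *Computational Complexity: A Modern Approach*, CUP 2009,
  §7.4.1 (error reduction), §A.2 (union bound), Thm. 2.18 (search to decision).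
-/

noncomputable section

namespace Literature.Computability.MetaComplexity

open _root_.Computability Complexity Filter Polynomial

/-! ### The error polynomial -/

/-- The target error of the amplified decider: `1/(errPoly(m) + 1) = 1/(6m + 6)`, so that the
union bound over the `2(n + 1)` canonical queries is exactly `1/3`.
[cite: ChenEtAl2022, §5.1 (proof of Thm. 5.4, case `𝒞 = BPP`)] -/
def errPoly : ℕ[X] :=
  6 * X + 5

/-- `errPoly(m) + 1 = 6(m + 1)` in `ℝ`. [folklore] -/
theorem errPoly_eval_succ (m : ℕ) : ((errPoly.eval m : ℕ) : ℝ) + 1 = 6 * ((m : ℝ) + 1) := by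
  simp only [errPoly, eval_add, eval_mul, eval_ofNat, eval_X]
  push_cast
  ring

/-! ### The data of the construction -/

/-- **The data of the refuter construction** for a fixed `EXP`-complete paddable `L` and a fixed
`L'' ∈ BPP` (the language of the refuted algorithm): an amplified `BPP`-witness `Lamp ∈ P` of
`L''` with coin polynomial `p''` and error `≤ 1/(6m + 6)` (step "standard amplification"), a Karp
reduction `f ∈ FP` of the search language `G_{L ∆ L''}` to `L` with output-length bound `s`
(step "since `L` is `𝒟`-complete"), and the padding map of `L` (step "since `L` is paddable").
[cite: ChenEtAl2022, §5.1 (proof of Thm. 5.4)] -/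
structure RefData (L L'' : Language Bool) where
  /-- The amplified witness language of `L''`. -/
  Lamp : Language Bool
  /-- The Karp reduction of `prefLang {y | y ∈ L ↔ y ∉ L''}` to `L`. -/
  f : List Bool → List Bool
  /-- The padding map of `L`. -/
  pad : List Bool × ℕ → List Bool
  /-- An output-length bound for `f`. -/
  s : ℕ[X]
  /-- The coin polynomial of `Lamp`. -/
  p'' : ℕ[X]
  hLamp : Lamp ∈ Classes.P
  hf : f ∈ FP
  hpad : PolyTimeComputable (fun p : List Bool × ℕ => boolPair p.1 (unaryEncodeNat p.2))
    (id : List Bool → List Bool) pad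
  hs : ∀ x : List Bool, (f x).length ≤ s.eval x.length
  hpads : ∀ (x : List Bool) (m : ℕ), x.length ≤ m → (pad (x, m)).length = m ∧ (pad (x, m) ∈ L ↔ x ∈ L)
  hfG : ∀ x : List Bool, x ∈ prefLang {y | y ∈ L ↔ y ∉ L''} ↔ f x ∈ L
  hyes : ∀ z ∈ L'', uniformProb (p''.eval z.length) {y : List Bool | boolPair z y ∉ Lamp} ≤
    1 / ((errPoly.eval z.length : ℕ) + 1 : ℝ)
  hno : ∀ z ∉ L'', uniformProb (p''.eval z.length) {y : List Bool | boolPair z y ∈ Lamp} ≤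
    1 / ((errPoly.eval z.length : ℕ) + 1 : ℝ)
  hdep : ∀ (z y : List Bool) (N : ℕ), p''.eval z.length ≤ N →
    (boolPair z (y.take N) ∈ Lamp ↔ boolPair z y ∈ Lamp)

namespace RefData

variable {L L'' : Language Bool} (D : RefData L L'')

/-! ### The query map and its exact length -/

/-- **The query length** `ℓ(n) = s(3n + 3) + n + 1`: at least the length of every reduced query
`f⟨1ⁿ, w⟩`, `|w| ≤ n + 1`, and strictly increasing ("for some strictly increasing polynomial
`ℓ`"). [cite: ChenEtAl2022, §5.1 (proof of Thm. 5.4)] -/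
def ℓ : ℕ[X] :=
  D.s.comp (3 * X + 3) + X + 1

/-- Value of `ℓ`. [folklore] -/
theorem ℓ_eval (n : ℕ) : D.ℓ.eval n = D.s.eval (3 * n + 3) + n + 1 := by
  simp only [ℓ, eval_add, eval_comp, eval_mul, eval_ofNat, eval_X, eval_one]

/-- `n < ℓ(n)`. [folklore] -/
theorem lt_ℓ (n : ℕ) : n < D.ℓ.eval n := by
  rw [ℓ_eval]
  omega

/-- `n ≤ ℓ(n)`. [folklore] -/
theorem le_ℓ (n : ℕ) : n ≤ D.ℓ.eval n :=
  (D.lt_ℓ n).le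

/-- `ℓ` is strictly increasing. [cite: ChenEtAl2022, §5.1 (proof of Thm. 5.4)] -/
theorem ℓ_strictMono : StrictMono fun n => D.ℓ.eval n := by
  intro a b hab
  show D.ℓ.eval a < D.ℓ.eval b
  rw [ℓ_eval, ℓ_eval]
  have := TM2Iter.eval_mono D.s (show 3 * a + 3 ≤ 3 * b + 3 by omega)
  omega

/-- **The query map** `Q⟨u, w⟩ = pad(f⟨1^{|u|}, w⟩, ℓ(|u|))`: reduce the `G`-instance `⟨1ⁿ, w⟩`
to `L` and pad to the exact length `ℓ(n)`. [cite: ChenEtAl2022, §5.1 (proof of Thm. 5.4)] -/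
def Q : List Bool → List Bool :=
  padStr D.pad ∘ fanoutFn (D.f ∘ fanoutFn (onesFn ∘ fstP) sndP) (Plumb.polyFn D.ℓ ∘ fstP)

/-- `Q ∈ FP`. [cite: ChenEtAl2022, §5.1 (proof of Thm. 5.4)] -/
theorem Q_mem_FP : D.Q ∈ FP :=
  comp_mem_FP (padStr_mem_FP D.hpad)
    (fanoutFn_mem_FP
      (comp_mem_FP D.hf (fanoutFn_mem_FP (comp_mem_FP onesFn_mem_FP fstP_mem_FP) sndP_mem_FP))
      (comp_mem_FP (Plumb.polyFn_mem_FP _) fstP_mem_FP))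

/-- Value of `Q` on a pair. [folklore] -/
theorem Q_boolPair (u w : List Bool) :
    D.Q (boolPair u w) = D.pad (D.f (boolPair (unaryEncodeNat u.length) w), D.ℓ.eval u.length) := by
  simp only [Q, Function.comp_apply, fanoutFn_apply, fstP_boolPair, sndP_boolPair, padStr_boolPair,
    Plumb.polyFn_apply, List.length_replicate, onesFn]

/-- The reduced query fits into the padding length: `|f⟨1ⁿ, w⟩| ≤ ℓ(n)` for `|w| ≤ n + 1`.
[cite: ChenEtAl2022, §5.1 (proof of Thm. 5.4)] -/
theorem length_f_le (n : ℕ) (w : List Bool) (hw : w.length ≤ n + 1) :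
    (D.f (boolPair (unaryEncodeNat n) w)).length ≤ D.ℓ.eval n := by
  refine (D.hs _).trans ?_
  rw [length_boolPair, show (unaryEncodeNat n).length = n from unary_decode_encode_nat n, ℓ_eval]
  have := TM2Iter.eval_mono D.s (show 2 * n + 2 + w.length ≤ 3 * n + 3 by omega)
  omega

/-- **Queries have length exactly `ℓ(n)`.** [cite: ChenEtAl2022, §5.1 (proof of Thm. 5.4)] -/
theorem length_Q (n : ℕ) (w : List Bool) (hw : w.length ≤ n + 1) :
    (D.Q (boolPair (unaryEncodeNat n) w)).length = D.ℓ.eval n := by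
  rw [Q_boolPair, show (unaryEncodeNat n).length = n from unary_decode_encode_nat n]
  exact (D.hpads _ _ (D.length_f_le n w hw)).1

/-- **Membership of a query in `L` is the truth of the search predicate**:
`Q⟨1ⁿ, w⟩ ∈ L ↔ ⟨1ⁿ, w⟩ ∈ G ↔ ∃ v, |v ++ w| = n ∧ v ++ w ∈ L ∆ L''`.
[cite: ChenEtAl2022, §5.1 (proof of Thm. 5.4)] -/
theorem Q_mem_iff (n : ℕ) (w : List Bool) (hw : w.length ≤ n + 1) :
    D.Q (boolPair (unaryEncodeNat n) w) ∈ L ↔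
      ∃ v : List Bool, (v ++ w).length = n ∧ (v ++ w ∈ L ↔ v ++ w ∉ L'') := by
  rw [Q_boolPair, show (unaryEncodeNat n).length = n from unary_decode_encode_nat n,
    (D.hpads _ _ (D.length_f_le n w hw)).2, ← D.hfG, boolPair_mem_prefLang, show (unaryEncodeNat n).length = n from unary_decode_encode_nat n]
  rfl

/-! ### The refuters as string functions -/

/-- **The core `B₀`**: the final state of Algorithm 1 with the coin oracle, `⟨u, r⟩ ↦ w*`
(`searchFnD` with stop language `stopLang` and extension oracle `orc`).
[cite: ChenEtAl2022, §5.1 (Algorithm 1 and the list-refuter lemma)] -/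
def F₀ : List Bool → List Bool :=
  searchFnD (stopLang D.Lamp D.Q) (orc D.Lamp D.Q) X

/-- `F₀ ∈ FP`. [cite: ChenEtAl2022, §5.1 (Algorithm 1)] -/
theorem F₀_mem_FP : D.F₀ ∈ FP :=
  searchFnD_mem_FP _ _ X (stopLang_mem_P _ _ D.hLamp D.Q_mem_FP) (orc_mem_P _ _ D.hLamp D.Q_mem_FP)

/-- The coin oracle at length `n` with coins `r`: `w ↦ [⟨Q⟨1ⁿ, w⟩, r⟩ ∈ Lamp]` ("`A'(·, r)`").
[cite: ChenEtAl2022, §5.1 (proof of Thm. 5.4, case `𝒞 = BPP`)] -/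
def Ocoin (n : ℕ) (r : List Bool) : List Bool → Prop :=
  fun w => boolPair (D.Q (boolPair (unaryEncodeNat n) w)) r ∈ D.Lamp

/-- The ideal oracle at length `n`: `w ↦ [Q⟨1ⁿ, w⟩ ∈ L'']` (the language of the refuted
algorithm `A`). [cite: ChenEtAl2022, §5.1 (proof of Thm. 5.4)] -/
def Ostar (n : ℕ) : List Bool → Prop :=
  fun w => D.Q (boolPair (unaryEncodeNat n) w) ∈ L''

/-- **`B₀` runs Algorithm 1 with the coin oracle.** [cite: ChenEtAl2022, §5.1 (Algorithm 1)] -/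
theorem F₀_boolPair (n : ℕ) (r : List Bool) :
    D.F₀ (boolPair (unaryEncodeNat n) r) = crun n (D.Ocoin n r) n := by
  rw [F₀, searchFnD_stop_orc, show (unaryEncodeNat n).length = n from unary_decode_encode_nat n]
  rfl

/-- **The refuters `B_e`, `e ∈ {id, 0·, 1·}`** as string functions: on `⟨1ᵐ, r⟩` recover `1ⁿ`
with `ℓ(n) = m` (`invFn`), run `B₀` on `⟨1ⁿ, r⟩`, and print the query `Q⟨1ⁿ, e(w*)⟩` (the list-refuter lemma:
"`B⁽ⁱ⁾` prints `x⁽ⁱ⁾ₙ` on input `1^{ℓ⁽ⁱ⁾(n)}`"). [cite: ChenEtAl2022, §5.1 (the list-refuter lemma)] -/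
def Fe (e : List Bool → List Bool) : List Bool → List Bool :=
  D.Q ∘ fanoutFn (fstP ∘ fstP) (e ∘ sndP) ∘ fanoutFn id D.F₀ ∘ fanoutFn (invFn D.ℓ ∘ fstP) sndP

/-- `Fe e ∈ FP` for `e ∈ FP`. [cite: ChenEtAl2022, §5.1 (the list-refuter lemma)] -/
theorem Fe_mem_FP {e : List Bool → List Bool} (he : e ∈ FP) : D.Fe e ∈ FP :=
  comp_mem_FP D.Q_mem_FP
    (comp_mem_FP (fanoutFn_mem_FP (comp_mem_FP fstP_mem_FP fstP_mem_FP) (comp_mem_FP he sndP_mem_FP))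
      (comp_mem_FP (fanoutFn_mem_FP (PolyTimeComputable.id _) D.F₀_mem_FP)
        (fanoutFn_mem_FP (comp_mem_FP (invFn_mem_FP _) fstP_mem_FP) sndP_mem_FP)))

/-- **`B_e` on `1^{ℓ(n)}` prints `Q⟨1ⁿ, e(w*)⟩`** where `w*` is `B₀`'s state on the same coins.
[cite: ChenEtAl2022, §5.1 (the list-refuter lemma)] -/
theorem Fe_boolPair (e : List Bool → List Bool) (n : ℕ) (r : List Bool) :
    D.Fe e (boolPair (unaryEncodeNat (D.ℓ.eval n)) r) =
      D.Q (boolPair (unaryEncodeNat n) (e (crun n (D.Ocoin n r) n))) := by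
  simp only [Fe, Function.comp_apply, fanoutFn_apply, fstP_boolPair, sndP_boolPair, id]
  rw [invFn_spec D.ℓ_strictMono D.le_ℓ n _ (unary_decode_encode_nat _), F₀_boolPair]

/-! ### The bad coins and the union bound -/

/-- **A bad event**: at the `k`-th state `w_k` of the canonical run against `L''` (short,
`|w_k| < n`), the coins answer the query `b w_k` unlike `L''`.
[cite: ChenEtAl2022, §5.1 (proof of Thm. 5.4, case `𝒞 = BPP`)] -/
def badEv (n : ℕ) (kb : ℕ × Bool) : Set (List Bool) :=
  {r | (crun n (D.Ostar n) kb.1).length < n ∧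
    ¬ (D.Ocoin n r (kb.2 :: crun n (D.Ostar n) kb.1) ↔ D.Ostar n (kb.2 :: crun n (D.Ostar n) kb.1))}

/-- **The bad coins**: some canonical query `b w_k`, `k ≤ n`, `b ∈ {0, 1}`, is answered unlike
`L''`. [cite: ChenEtAl2022, §5.1 (proof of Thm. 5.4, case `𝒞 = BPP`)] -/
def badCoins (n : ℕ) : Set (List Bool) :=
  ⋃ kb ∈ Finset.range (n + 1) ×ˢ (Finset.univ : Finset Bool), D.badEv n kb

/-- **Each bad event has probability `≤ 1/(6(n + 1))`**: the query `q = Q⟨1ⁿ, b w_k⟩` has length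
`ℓ(n) ≥ n`, the event depends on the first `p''(ℓ(n))` coins only, and the amplified witness errs
on `q` with probability `≤ 1/(errPoly(ℓ(n)) + 1) ≤ 1/(6(n + 1))`.
[cite: ChenEtAl2022, §5.1 (proof of Thm. 5.4, case `𝒞 = BPP`)] -/
theorem uniformProb_badEv_le (n : ℕ) (kb : ℕ × Bool) :
    uniformProb (D.p''.eval (D.ℓ.eval n)) (D.badEv n kb) ≤ 1 / (6 * ((n : ℝ) + 1)) := by
  obtain ⟨k, b⟩ := kb
  by_cases hlt : (crun n (D.Ostar n) k).length < n
  · set w' : List Bool := b :: crun n (D.Ostar n) k with hw'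
    set q : List Bool := D.Q (boolPair (unaryEncodeNat n) w') with hq
    have hw'len : w'.length ≤ n + 1 := by
      rw [hw', List.length_cons]
      omega
    have hqlen : q.length = D.ℓ.eval n := D.length_Q n w' hw'len
    have hset : D.badEv n (k, b) = {r : List Bool | ¬ (boolPair q r ∈ D.Lamp ↔ q ∈ L'')} := by
      ext r
      simp only [badEv, Set.mem_setOf_eq, Ocoin, Ostar]
      exact ⟨fun h => h.2, fun h => ⟨hlt, h⟩⟩
    have hset2 : {r : List Bool | ¬ (boolPair q r ∈ D.Lamp ↔ q ∈ L'')} =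
        {r | r.take (D.p''.eval q.length) ∈ {y : List Bool | ¬ (boolPair q y ∈ D.Lamp ↔ q ∈ L'')}} := by
      ext r
      simp only [Set.mem_setOf_eq]
      rw [D.hdep q r _ le_rfl]
    rw [hset, hset2, uniformProb_take_of_le (by rw [hqlen])]
    have hbound : uniformProb (D.p''.eval q.length) {y : List Bool | ¬ (boolPair q y ∈ D.Lamp ↔ q ∈ L'')} ≤
        1 / ((errPoly.eval q.length : ℕ) + 1 : ℝ) := by
      by_cases hqL : q ∈ L''
      · have e : {y : List Bool | ¬ (boolPair q y ∈ D.Lamp ↔ q ∈ L'')} = {y | boolPair q y ∉ D.Lamp} := by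
          ext y
          simp [hqL]
        rw [e]
        exact D.hyes q hqL
      · have e : {y : List Bool | ¬ (boolPair q y ∈ D.Lamp ↔ q ∈ L'')} = {y | boolPair q y ∈ D.Lamp} := by
          ext y
          simp [hqL]
        rw [e]
        exact D.hno q hqL
    refine hbound.trans ?_
    rw [errPoly_eval_succ, hqlen]
    have h1 : (n : ℝ) ≤ (D.ℓ.eval n : ℕ) := by exact_mod_cast D.le_ℓ n
    exact one_div_le_one_div_of_le (by positivity) (by linarith)
  · have e : D.badEv n (k, b) = ∅ := by
      ext r
      simp only [badEv, Set.mem_setOf_eq, Set.mem_empty_iff_false, iff_false, not_and]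
      exact fun h => absurd h hlt
    rw [e, uniformProb_empty]
    positivity

/-- **The union bound**: the bad coins have probability `≤ 2(n + 1) · 1/(6(n + 1)) = 1/3`.
[cite: ChenEtAl2022, §5.1 (proof of Thm. 5.4, case `𝒞 = BPP`)] -/
theorem uniformProb_badCoins_le (n : ℕ) :
    uniformProb (D.p''.eval (D.ℓ.eval n)) (D.badCoins n) ≤ 1 / 3 := by
  unfold badCoins
  refine (uniformProb_biUnion_le _ _ _).trans ?_
  refine (Finset.sum_le_sum fun kb _ => D.uniformProb_badEv_le n kb).trans ?_
  rw [Finset.sum_const, Finset.card_product, Finset.card_range, Finset.card_univ, Fintype.card_bool,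
    nsmul_eq_mul]
  push_cast
  have hn : (0 : ℝ) < (n : ℝ) + 1 := by positivity
  rw [show ((n : ℝ) + 1) * 2 * (1 / (6 * ((n : ℝ) + 1))) = 1 / 3 by field_simp; ring]

/-- **Good coins follow the canonical run against `L''`**: outside `badCoins n` the run with the
coin oracle coincides with the run with the ideal oracle (`crun_congr`) — on those coins
"`A'(·, r)` decides the same language as `A`" on every query made.
[cite: ChenEtAl2022, §5.1 (proof of Thm. 5.4, case `𝒞 = BPP`)] -/
theorem crun_eq_of_not_mem_badCoins {n : ℕ} {r : List Bool} (hr : r ∉ D.badCoins n) (k : ℕ) :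
    crun n (D.Ocoin n r) k = crun n (D.Ostar n) k := by
  refine crun_congr (fun j hj hlt b => ?_) k
  by_contra hne
  refine hr (Set.mem_iUnion₂.2 ⟨(j, b), Finset.mem_product.2 ⟨Finset.mem_range.2 (Nat.lt_succ_of_le hj),
    Finset.mem_univ _⟩, ?_⟩)
  exact ⟨hlt, hne⟩

/-- **Success with probability `2/3`**: a `strRefuter` whose output is in the target event for
every good coin string succeeds with probability `≥ 1 - 1/3`.
[cite: ChenEtAl2022, §5.1 (proof of Thm. 5.4, case `𝒞 = BPP`)] -/
theorem pr_ge_of_good {F : List Bool → List Bool} {c : ℕ[X]} {m n : ℕ} {E : Set (List Bool)}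
    (hc : c.eval m = D.p''.eval (D.ℓ.eval n))
    (hsub : ∀ r : List Bool, r ∉ D.badCoins n → F (boolPair (unaryEncodeNat m) r) ∈ E) :
    (2 : ℝ) / 3 ≤ (strRefuter F c).pr unaryEncodeNat m E := by
  rw [strRefuter_pr, hc]
  have h1 := D.uniformProb_badCoins_le n
  have h2 : (D.badCoins n)ᶜ ⊆ {r : List Bool | F (boolPair (unaryEncodeNat m) r) ∈ E} :=
    fun r hr => hsub r hr
  have h3 := PromiseCook.uniformProb_mono (m := D.p''.eval (D.ℓ.eval n)) h2
  rw [uniformProb_compl] at h3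
  linarith

/-! ### One of the four refuters succeeds at every bad length -/

/-- Propositional bookkeeping: if `a ↔ b` fails then `b ↔ ¬ a`. [folklore] -/
theorem iff_not_of_not_iff {a b : Prop} (h : ¬ (a ↔ b)) : b ↔ ¬ a := by
  tauto

/-- Consistency of the ideal oracle with the truth at a query `w'` is agreement of `L''` with `L`
on the padded query `Q⟨1ⁿ, w'⟩` ("either `R^A` solves `G_A(1ⁿ, x)` correctly, or `A` gives the
incorrect answer on at least one of the queries").
[cite: ChenEtAl2022, §5.1 (proof of Thm. 5.4)] -/
theorem Ostar_iff_iff (n : ℕ) (w' : List Bool) (hw' : w'.length ≤ n + 1) :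
    (D.Ostar n w' ↔ ∃ v : List Bool, (v ++ w').length = n ∧ (v ++ w' ∈ L ↔ v ++ w' ∉ L'')) ↔
      (D.Q (boolPair (unaryEncodeNat n) w') ∈ L'' ↔ D.Q (boolPair (unaryEncodeNat n) w') ∈ L) := by
  simp only [Ostar]
  rw [D.Q_mem_iff n w' hw']

/-- **At a bad length `n ≥ 1`, one of `B₀` (at `n`) and `B_id`, `B₀.`, `B₁.` (at `ℓ(n)`) prints a
counterexample of the right length with probability `≥ 2/3`.** If `L''` disagrees with `L` on one
of the three queries `Q⟨1ⁿ, w*⟩`, `Q⟨1ⁿ, 0w*⟩`, `Q⟨1ⁿ, 1w*⟩` at the canonical final state `w*`,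
that query (of length `ℓ(n)`) is a counterexample printed by the corresponding `B_e` on all good
coins; otherwise `crun_full_of_consistent` makes `w*` itself an `n`-bit counterexample, printed by
`B₀` on all good coins. [cite: ChenEtAl2022, §5.1 (proof of Thm. 5.4 and of the list-refuter lemma)] -/
theorem exists_success (n : ℕ) (hn : 1 ≤ n)
    (hbad : ∃ y : List Bool, y.length = n ∧ (y ∈ L ↔ y ∉ L'')) :
    (2 : ℝ) / 3 ≤ (strRefuter D.F₀ (D.p''.comp D.ℓ)).pr unaryEncodeNat n
        {x | x.length = n ∧ (x ∈ L ↔ x ∉ L'')} ∨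
      (2 : ℝ) / 3 ≤ (strRefuter (D.Fe id) D.p'').pr unaryEncodeNat (D.ℓ.eval n)
        {x | x.length = D.ℓ.eval n ∧ (x ∈ L ↔ x ∉ L'')} ∨
      (2 : ℝ) / 3 ≤ (strRefuter (D.Fe (List.cons false)) D.p'').pr unaryEncodeNat (D.ℓ.eval n)
        {x | x.length = D.ℓ.eval n ∧ (x ∈ L ↔ x ∉ L'')} ∨
      (2 : ℝ) / 3 ≤ (strRefuter (D.Fe (List.cons true)) D.p'').pr unaryEncodeNat (D.ℓ.eval n)
        {x | x.length = D.ℓ.eval n ∧ (x ∈ L ↔ x ∉ L'')} := by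
  set w : List Bool := crun n (D.Ostar n) n with hw
  have hwlen : w.length ≤ n := (crun_inv n (D.Ostar n) n).2
  have hgood : ∀ r : List Bool, r ∉ D.badCoins n → crun n (D.Ocoin n r) n = w := fun r hr =>
    D.crun_eq_of_not_mem_badCoins hr n
  have hM : (D.p''.comp D.ℓ).eval n = D.p''.eval (D.ℓ.eval n) := eval_comp
  have hw0 : (false :: w).length ≤ n + 1 := by rw [List.length_cons]; omega
  have hw1 : (true :: w).length ≤ n + 1 := by rw [List.length_cons]; omega
  by_cases c₁ : (D.Q (boolPair (unaryEncodeNat n) w) ∈ L'' ↔ D.Q (boolPair (unaryEncodeNat n) w) ∈ L)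
  · by_cases c₂ : (D.Q (boolPair (unaryEncodeNat n) (false :: w)) ∈ L'' ↔
        D.Q (boolPair (unaryEncodeNat n) (false :: w)) ∈ L)
    · by_cases c₃ : (D.Q (boolPair (unaryEncodeNat n) (true :: w)) ∈ L'' ↔
          D.Q (boolPair (unaryEncodeNat n) (true :: w)) ∈ L)
      · -- position 0: `w*` itself is an `n`-bit counterexample
        left
        have hfull := crun_full_of_consistent (n := n) (O := D.Ostar n)
          (Bad := fun y : List Bool => (y ∈ L ↔ y ∉ L'')) hn hbad
          (fun _ => (D.Ostar_iff_iff n w (by omega)).2 c₁)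
          (fun _ => (D.Ostar_iff_iff n (false :: w) hw0).2 c₂)
          (fun _ => (D.Ostar_iff_iff n (true :: w) hw1).2 c₃)
        refine D.pr_ge_of_good hM fun r hr => ?_
        rw [Set.mem_setOf_eq, D.F₀_boolPair, hgood r hr]
        exact hfull
      · -- position 3: the query `Q⟨1ⁿ, 1w*⟩`
        right; right; right
        refine D.pr_ge_of_good rfl fun r hr => ?_
        rw [Set.mem_setOf_eq, D.Fe_boolPair, hgood r hr]
        exact ⟨D.length_Q n _ hw1, iff_not_of_not_iff c₃⟩
    · -- position 2: the query `Q⟨1ⁿ, 0w*⟩`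
      right; right; left
      refine D.pr_ge_of_good rfl fun r hr => ?_
      rw [Set.mem_setOf_eq, D.Fe_boolPair, hgood r hr]
      exact ⟨D.length_Q n _ hw0, iff_not_of_not_iff c₂⟩
  · -- position 1: the query `Q⟨1ⁿ, w*⟩`
    right; left
    refine D.pr_ge_of_good rfl fun r hr => ?_
    rw [Set.mem_setOf_eq, D.Fe_boolPair, hgood r hr, id]
    exact ⟨D.length_Q n _ (by omega), iff_not_of_not_iff c₁⟩

/-! ### Pigeonhole over the bad lengths (list-refuters to refuters) -/

/-- Infinitely many `n` with `P(ℓ(n))` give infinitely many `m` with `P(m)` (`ℓ(n) ≥ n`).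
[cite: ChenEtAl2022, §5.1 (proof of the list-refuter lemma)] -/
theorem frequently_of_frequently_ℓ {P : ℕ → Prop} (h : ∃ᶠ n in atTop, P (D.ℓ.eval n)) :
    ∃ᶠ m in atTop, P m := by
  rw [frequently_atTop] at h ⊢
  intro a
  obtain ⟨n, hn, hP⟩ := h a
  exact ⟨D.ℓ.eval n, hn.trans (D.le_ℓ n), hP⟩

/-- A `strRefuter` of an `FP` map that succeeds infinitely often is a `BPP`-refuter.
[cite: ChenEtAl2022, Def. 1.1] -/
theorem isBPPRefuter_strRefuter {F : List Bool → List Bool} (hF : F ∈ FP) (c : ℕ[X])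
    (h : ∃ᶠ m in atTop, (2 : ℝ) / 3 ≤ (strRefuter F c).pr unaryEncodeNat m
      {x | x.length = m ∧ (x ∈ L ↔ x ∉ L'')}) :
    IsBPPRefuter L L'' (strRefuter F c) :=
  ⟨strRefuter_isPolyTime F c hF, ⟨c, fun _ => rfl⟩, h⟩

include D in
/-- **Thm. 5.4 with the list-refuter lemma, for the fixed pair `(L, L'')`**: if bad lengths are infinitely many,
one of the four refuters `B₀`, `B_id`, `B₀.`, `B₁.` is a `BPP`-refuter for `L` against `L''`
(pigeonhole: `Filter.frequently_or_distrib`; for the latter three the success lengths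
`m = ℓ(n)` tend to infinity). [cite: ChenEtAl2022, §5.1 (the list-refuter lemma and Thm. 5.4)] -/
theorem exists_refuter (hfreq : ∃ᶠ n in atTop, ∃ y : List Bool, y.length = n ∧ (y ∈ L ↔ y ∉ L'')) :
    ∃ R : RandAlg ℕ (List Bool), IsBPPRefuter L L'' R := by
  have hfreq' := (hfreq.and_eventually (eventually_ge_atTop 1)).mono
    fun n h => D.exists_success n h.2 h.1
  rcases frequently_or_distrib.1 hfreq' with h | h'
  · exact ⟨_, isBPPRefuter_strRefuter D.F₀_mem_FP _ h⟩
  rcases frequently_or_distrib.1 h' with h | h'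
  · exact ⟨_, isBPPRefuter_strRefuter (D.Fe_mem_FP (PolyTimeComputable.id _)) _
      (D.frequently_of_frequently_ℓ h)⟩
  rcases frequently_or_distrib.1 h' with h | h
  · exact ⟨_, isBPPRefuter_strRefuter (D.Fe_mem_FP (cons_mem_FP false)) _
      (D.frequently_of_frequently_ℓ h)⟩
  · exact ⟨_, isBPPRefuter_strRefuter (D.Fe_mem_FP (cons_mem_FP true)) _
      (D.frequently_of_frequently_ℓ h)⟩

end RefData

/-! ### The theorem -/

/-- **Discharge of `constructiveSeparation_of_not_subset_BPP_EXP`** — Thm. 1.2 of Chen–Jin–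
Santhanam–Williams for `(𝒞, 𝒟) = (BPP, EXP)`: if `EXP ⊄ BPP`, then for every paddable
`EXP`-complete `L` and every `L'' ∈ BPP` there is a `BPP`-refuter for `L` against `L''`. Assemble
`RefData` — the disagreement set `L ∆ L'' ∈ EXP` (`BPP ⊆ EXP`, Boolean closure through the
complete `L`), the search language `G ∈ EXP` and its reduction `f` to `L`, the padding map, and an
amplified witness of `L''` with error `1/(6m + 6)` — and apply `RefData.exists_refuter` to the
infinitely many bad lengths (`frequently_exists_mismatch`).
[cite: ChenEtAl2022, Thm. 1.2 (proof: §5.1, Thm. 5.4 with the list-refuter lemma)] -/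
theorem constructiveSeparation_of_not_subset_BPP_EXP_holds :
    constructiveSeparation_of_not_subset_BPP_EXP := by
  intro hEXP L hL hpad L'' hL''
  have hfreq := frequently_exists_mismatch hEXP hL hpad hL''
  obtain ⟨pad, hpadc, hpads⟩ := hpad
  have hS : ({y | y ∈ L ↔ y ∉ L''} : Language Bool) ∈ EXP :=
    setOf_iff_not_mem_EXP_of_complete hL hL.1 (BPP_subset_EXP hL'')
  have hG : prefLang {y | y ∈ L ↔ y ∉ L''} ∈ EXP := prefLang_mem_EXP hL hS
  obtain ⟨f, hf, hfG⟩ := hL.2 _ hG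
  have hfG' : ∀ x : List Bool, x ∈ prefLang {y | y ∈ L ↔ y ∉ L''} ↔ f x ∈ L := fun x => hfG x
  obtain ⟨s, hs⟩ := exists_poly_length_le_of_mem_FP hf
  obtain ⟨Lamp, hLamp, p'', hyes, hno, hdep⟩ :=
    PromiseProblem.exists_amplifier_of_mem_PromiseBPP' (ofLanguage_mem_PromiseBPP'_iff.2 hL'') errPoly
  let D : RefData L L'' :=
    { Lamp := Lamp, f := f, pad := pad, s := s, p'' := p'', hLamp := hLamp, hf := hf, hpad := hpadc,
      hs := hs, hpads := hpads, hfG := hfG', hyes := fun z hz => hyes z hz, hno := fun z hz => hno z hz,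
      hdep := hdep }
  exact D.exists_refuter hfreq

end Literature.Computability.MetaComplexity

end
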